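import Summits.AtomisticToContinuum.BoseEinsteinCondensation.Theorems.BECCellInformationCoarseChainRule
import Summits.AtomisticToContinuum.BoseEinsteinCondensation.Theorems.BECCellInformationTwoScaleReductionChainRule

/-!
# Crux `OneBodyEntropyBound` (stmt-AtomisticToContinuum-13440), line `registered`:
# stub `stub_cellChainRule` — the exact KL chain rule over the cell tiling for the one-body marginal

Helper file (`--supports stmt-AtomisticToContinuum-13440`). For a trial state `Ψ ∈ TrialState (n+1) L`
let `P¹(x) = ∫ |Ψ(x :: Y')|² dY'` be the one-body marginal (continuous, vanishing off `Λ_L`,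
`∫ P¹ = 1`), tile `[0,L)³` by the `M³` half-open cells `Q_k` of side `s = L/M`, `P_k = ∫_{Q_k} P¹`.
Then, in `[0,∞]`,

  `∫_{Λ_L} L⁻³ klFun(L³ P¹) ≤ Σ_k M⁻³ klFun(M³ P_k) + Σ_k ∫_{Q_k} (P_k/s³) klFun(s³ P¹ / P_k)`

(it holds with equality: `KL(P¹ ‖ u_Λ) = KL(P ‖ ū) + Σ_k P_k KL(P¹_k ‖ u_k)`). Proof summary:
1. `P¹` is continuous (parametric integral of the continuous compactly supported `|Ψ(x :: Y')|²`
   over a compact box in `Y'`), `≥ 0`, `= 0` off `Λ_L` (Dirichlet), `∫ P¹ = 1` (Fubini);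
2. `∫_{Λ} L⁻³ klFun(L³φ) = ∫ φ log(L³φ)` (the affine part of `klFun` integrates to `0`);
3. tiling `∫ = Σ_k ∫_{Q_k}` (`integral_eq_sum_subCell`; the cells are the `subCell s k`);
4. per cell `∫_Q φ log(L³φ) = ∫_Q φ log(s³φ/P_k) + P_k log(M³P_k)` (`L³ = M³s³`), and
   `Σ_k P_k log(M³P_k) = Σ_k M⁻³ klFun(M³P_k)`, `∫_Q (P_k/s³) klFun(s³φ/P_k) = ∫_Q φ log(s³φ/P_k)`;
5. `ofReal (a + b) ≤ ofReal a + ofReal b`.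
Model: `TwoScaleReduction.fibre_two_scale` (Steps 2–4) with `φ = P¹`, `m = 1`.
-/

noncomputable section

namespace Summit.AtomisticToContinuum.BoseEinsteinCondensation.Cruxes.OneBodyEntropyBound.Birth

open MeasureTheory Set InformationTheory
open scoped ENNReal
open Literature.MathematicalPhysics.QuantumManyBody.BoseGas
open Summit.AtomisticToContinuum.BoseEinsteinCondensation.Theorems
open Summit.AtomisticToContinuum.BoseEinsteinCondensation.Theorems.TwoScaleReduction

namespace CellChainRule

/-! ### Regularity of the one-body marginal -/

/-- `φ log(a φ)` is continuous for continuous `φ`. [folklore] -/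
theorem continuous_mul_log_mul {X : Type*} [TopologicalSpace X] {φ : X → ℝ}
    (hφ : Continuous φ) (a : ℝ) : Continuous fun x => φ x * Real.log (a * φ x) := by
  simpa only [div_one] using continuous_mul_log_mul_div hφ a 1

/-- The one-body marginal `x ↦ ∫ |Ψ(x :: Y')|² dY'` of a trial state is continuous: the integrand
is jointly continuous and, in `Y'`, supported in the compact closed box `([0,L]³)ⁿ`. [folklore] -/
theorem continuous_integral_normSq_vecCons {n : ℕ} {L : ℝ} (Ψ : TrialState (n + 1) L) :
    Continuous fun x : Space => ∫ Y : Config n, ‖Ψ.ψ (Matrix.vecCons x Y)‖ ^ 2 := by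
  set K : Set (Config n) := Set.pi Set.univ fun _ => {y : Space | ∀ j, y j ∈ Icc (0 : ℝ) L}
    with hK_def
  have hK : IsCompact K :=
    isCompact_univ_pi fun _ => isCompact_IccCell (m := 3) (fun _ => 0) (fun _ => L)
  have hmem : ∀ (x : Space) (Y : Config n), Matrix.vecCons x Y ∈ boxN (n + 1) L → Y ∈ K := by
    intro x Y hX
    refine Set.mem_univ_pi.2 fun i j => ?_
    have h : (Matrix.vecCons x Y : Config (n + 1)) i.succ j ∈ Ioo 0 L := hX i.succ j
    rw [Matrix.cons_val_succ] at h
    exact Ioo_subset_Icc_self h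
  have hzero : ∀ (x : Space) (Y : Config n), Y ∉ K → ‖Ψ.ψ (Matrix.vecCons x Y)‖ ^ 2 = 0 := by
    intro x Y hY
    rw [Ψ.eq_zero _ fun hX => hY (hmem x Y hX)]
    simp
  have heq : (fun x : Space => ∫ Y : Config n, ‖Ψ.ψ (Matrix.vecCons x Y)‖ ^ 2) =
      fun x => ∫ Y in K, ‖Ψ.ψ (Matrix.vecCons x Y)‖ ^ 2 :=
    funext fun x => (setIntegral_eq_integral_of_forall_compl_eq_zero fun Y hY => hzero x Y hY).symm
  rw [heq]
  have hF : Continuous fun p : Space × Config n => ‖Ψ.ψ (Matrix.vecCons p.1 p.2)‖ ^ 2 :=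
    (Ψ.contDiff.continuous.comp (continuous_fst.matrixVecCons continuous_snd)).norm.pow 2
  exact continuous_parametric_integral_of_continuous
    (f := fun (x : Space) (Y : Config n) => ‖Ψ.ψ (Matrix.vecCons x Y)‖ ^ 2) hF hK

/-- The one-body marginal vanishes off the open box (Dirichlet condition in the tagged particle).
[folklore] -/
theorem integral_normSq_vecCons_eq_zero {n : ℕ} {L : ℝ} (Ψ : TrialState (n + 1) L) (x : Space)
    (hx : x ∉ box L) : ∫ Y : Config n, ‖Ψ.ψ (Matrix.vecCons x Y)‖ ^ 2 = 0 := by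
  simp [CoarseChainRule.normSq_vecCons_eq_zero Ψ hx]

/-- The one-body marginal integrates to one. [folklore] -/
theorem integral_integral_normSq_vecCons' {n : ℕ} {L : ℝ} (Ψ : TrialState (n + 1) L) :
    ∫ x : Space, ∫ Y : Config n, ‖Ψ.ψ (Matrix.vecCons x Y)‖ ^ 2 = 1 := by
  have h := CoarseChainRule.integral_setIntegral_normSq_vecCons_swap Ψ Set.univ
  simp only [Measure.restrict_univ] at h
  rw [← h]
  exact CoarseChainRule.integral_integral_normSq_vecCons Ψ

/-! ### The exact chain rule over the cell tiling for a continuous one-body density -/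

/-- **KL chain rule over the cell tiling.** For a continuous `φ ≥ 0` on `ℝ³` vanishing off the open
box `Λ_L` with `∫ φ = 1`, and the tiling of `[0,L)³` by the `M³` cells `subCell (L/M) q`
(`A_q = ∫_{Q_q} φ`, `s = L/M`):
`∫_{Λ_L} L⁻³ klFun(L³φ) ≤ Σ_q M⁻³ klFun(M³A_q) + Σ_q ∫_{Q_q} (A_q/s³) klFun(s³φ/A_q)` in `[0,∞]`
(in fact an equality: `KL(φ ‖ u_Λ) = KL(A ‖ ū) + Σ_q A_q KL(φ_q ‖ u_q)`).
[cite: CoverThomas2005, Thm 2.5.3] -/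
theorem lintegral_klFun_le_coarse_add_within {L : ℝ} (hL : 0 < L) {M : ℕ} (hM : 1 ≤ M)
    {φ : Space → ℝ} (hφc : Continuous φ) (hφ0 : ∀ x, 0 ≤ φ x)
    (hsupp : ∀ x, x ∉ box L → φ x = 0) (hone : ∫ x, φ x = 1) :
    ∫⁻ x in box L, ENNReal.ofReal ((L ^ 3)⁻¹ * klFun (L ^ 3 * φ x)) ≤
      ENNReal.ofReal (∑ q : Fin 3 → Fin M, ((M : ℝ) ^ 3)⁻¹ *
          klFun ((M : ℝ) ^ 3 * ∫ x in subCell (L / (M : ℝ)) q, φ x)) +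
        ENNReal.ofReal (∑ q : Fin 3 → Fin M, ∫ x in subCell (L / (M : ℝ)) q,
          (∫ z in subCell (L / (M : ℝ)) q, φ z) / (L / (M : ℝ)) ^ 3 *
            klFun ((L / (M : ℝ)) ^ 3 * φ x / ∫ z in subCell (L / (M : ℝ)) q, φ z)) := by
  set s : ℝ := L / M with hs_def
  have hMpos : (0 : ℝ) < M := by exact_mod_cast hM
  have hs : 0 < s := div_pos hL hMpos
  have hMs : (M : ℝ) * s = L := by rw [hs_def]; field_simp
  have hL3 : L ^ 3 = (M : ℝ) ^ 3 * s ^ 3 := by rw [← hMs]; ring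
  set A : (Fin 3 → Fin M) → ℝ := fun q => ∫ x in subCell s q, φ x with hA_def
  have hAfold : ∀ q, ∫ x in subCell s q, φ x = A q := fun q => rfl
  /- compactness of the closed box; integrability of continuous functions -/
  have hK : IsCompact {y : Space | ∀ j, y j ∈ Icc (0 : ℝ) L} :=
    isCompact_IccCell (m := 3) (fun _ => 0) (fun _ => L)
  have hboxK : box L ⊆ {y : Space | ∀ j, y j ∈ Icc (0 : ℝ) L} :=
    fun y hy j => Ioo_subset_Icc_self (hy j)
  have hcellK : ∀ q : Fin 3 → Fin M, subCell s q ⊆ {y : Space | ∀ j, y j ∈ Icc (0 : ℝ) L} :=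
    fun q y hy j => by
      have h := subCell_subset_cell hs q hy j
      rw [hMs] at h
      exact Ico_subset_Icc_self h
  have hint : ∀ {F : Space → ℝ}, Continuous F → (∀ x, x ∉ box L → F x = 0) → Integrable F :=
    fun hF h0 => hF.integrable_of_hasCompactSupport
      (HasCompactSupport.intro hK fun x hx => h0 x fun hb => hx (hboxK hb))
  have hintOn : ∀ {F : Space → ℝ}, Continuous F → ∀ q : Fin 3 → Fin M,
      IntegrableOn F (subCell s q) :=
    fun hF q => (hF.continuousOn.integrableOn_compact hK).mono_set (hcellK q)
  have hA0 : ∀ q, 0 ≤ A q := fun q => integral_nonneg fun x => hφ0 x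
  have hvolQ : ∀ q : Fin 3 → Fin M, volume.real (subCell s q) = s ^ 3 := fun q => by
    rw [measureReal_def, ← routeCell_eq_subCell s q, CoarseChainRule.volume_cell hs.le q,
      ENNReal.toReal_ofReal (by positivity)]
  /- the left-hand side as a real integral -/
  have hklnn : ∀ x, 0 ≤ (L ^ 3)⁻¹ * klFun (L ^ 3 * φ x) := fun x =>
    mul_nonneg (by positivity) (klFun_nonneg (mul_nonneg (by positivity) (hφ0 x)))
  have hklc : Continuous fun x => (L ^ 3)⁻¹ * klFun (L ^ 3 * φ x) :=
    continuous_const.mul (continuous_klFun.comp (continuous_const.mul hφc))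
  have hTint : IntegrableOn (fun x => (L ^ 3)⁻¹ * klFun (L ^ 3 * φ x)) (box L) :=
    (hklc.continuousOn.integrableOn_compact hK).mono_set hboxK
  rw [← ofReal_integral_eq_lintegral_ofReal hTint (ae_of_all _ hklnn)]
  /- Step 2: `∫_Λ L⁻³ klFun(L³φ) = ∫ φ log(L³φ)` -/
  have hvolbox : volume.real (box L) = L ^ 3 := by
    rw [measureReal_def, volume_box, ← ENNReal.ofReal_pow hL.le,
      ENNReal.toReal_ofReal (by positivity)]
  have i1 : Integrable fun x => φ x * Real.log (L ^ 3 * φ x) :=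
    hint (continuous_mul_log_mul hφc _) fun x hx => by simp [hsupp x hx]
  have i2 : Integrable φ := hint hφc hsupp
  have hT : ∫ x in box L, (L ^ 3)⁻¹ * klFun (L ^ 3 * φ x) =
      ∫ x, φ x * Real.log (L ^ 3 * φ x) := by
    have hpt : ∀ x, (L ^ 3)⁻¹ * klFun (L ^ 3 * φ x) =
        φ x * Real.log (L ^ 3 * φ x) + ((L ^ 3)⁻¹ - φ x) := by
      intro x; rw [klFun_apply]; field_simp; ring
    simp_rw [hpt]
    have hvb : volume (box L) ≠ ⊤ := by rw [volume_box]; simp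
    have ic : IntegrableOn (fun _ : Space => (L ^ 3)⁻¹) (box L) := integrableOn_const hvb
    have i3 : IntegrableOn (fun x => (L ^ 3)⁻¹ - φ x) (box L) := ic.sub i2.integrableOn
    rw [integral_add i1.integrableOn i3, integral_sub ic i2.integrableOn,
      setIntegral_const, hvolbox, smul_eq_mul,
      setIntegral_eq_integral_of_forall_compl_eq_zero (s := box L)
        (fun x hx => by simp [hsupp x hx]),
      setIntegral_eq_integral_of_forall_compl_eq_zero (s := box L) hsupp, hone]
    have hL0 : L ≠ 0 := hL.ne'
    have hz : L ^ 3 * (L ^ 3)⁻¹ - 1 = 0 := by field_simp; ring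
    rw [hz, add_zero]
  rw [hT]
  /- Step 3: tiling -/
  have hTsum : ∫ x, φ x * Real.log (L ^ 3 * φ x) =
      ∑ q : Fin 3 → Fin M, ∫ x in subCell s q, φ x * Real.log (L ^ 3 * φ x) :=
    integral_eq_sum_subCell hs hMs (fun x hx => by simp [hsupp x hx]) i1
  have hAsum : ∑ q : Fin 3 → Fin M, A q = 1 :=
    (integral_eq_sum_subCell hs hMs hsupp i2).symm.trans hone
  /- Step 4: the chain rule on each cell -/
  have hsplit : ∀ q : Fin 3 → Fin M,
      ∫ x in subCell s q, φ x * Real.log (L ^ 3 * φ x) =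
        (∫ x in subCell s q, φ x * Real.log (s ^ 3 * φ x / A q)) +
          A q * Real.log ((M : ℝ) ^ 3 * A q) := by
    intro q
    have iφ : IntegrableOn φ (subCell s q) := i2.integrableOn
    rcases (hA0 q).eq_or_lt with hAq | hAq
    · -- empty cell: `φ = 0` a.e. on it
      have hae : φ =ᵐ[volume.restrict (subCell s q)] 0 :=
        (integral_eq_zero_iff_of_nonneg hφ0 iφ).1 hAq.symm
      rw [integral_eq_zero_of_ae (hae.mono fun x hx => by simp [hx]),
        integral_eq_zero_of_ae (hae.mono fun x hx => by simp [hx]), ← hAq]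
      simp
    · have hpt : ∀ x, φ x * Real.log (L ^ 3 * φ x) =
          φ x * Real.log (s ^ 3 * φ x / A q) + φ x * Real.log ((M : ℝ) ^ 3 * A q) := by
        intro x
        rcases (hφ0 x).eq_or_lt with h0 | hpos
        · rw [← h0]; simp
        · rw [← mul_add, ← Real.log_mul (by positivity) (by positivity)]
          congr 2
          rw [hL3]; field_simp
      simp_rw [hpt]
      rw [integral_add (hintOn (continuous_mul_log_mul_div hφc _ _) q) (iφ.mul_const _),
        integral_mul_const]
  /- the coarse part: `Σ_q A_q log(M³A_q) = Σ_q M⁻³ klFun(M³A_q)` -/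
  have hcoarse : ∑ q : Fin 3 → Fin M, A q * Real.log ((M : ℝ) ^ 3 * A q) =
      ∑ q : Fin 3 → Fin M, ((M : ℝ) ^ 3)⁻¹ * klFun ((M : ℝ) ^ 3 * A q) := by
    have hpt : ∀ q : Fin 3 → Fin M, ((M : ℝ) ^ 3)⁻¹ * klFun ((M : ℝ) ^ 3 * A q) =
        A q * Real.log ((M : ℝ) ^ 3 * A q) + (((M : ℝ) ^ 3)⁻¹ - A q) := by
      intro q; rw [klFun_apply]; field_simp; ring
    simp_rw [hpt]
    rw [Finset.sum_add_distrib, Finset.sum_sub_distrib, hAsum, Finset.sum_const, Finset.card_univ,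
      Fintype.card_fun]
    simp only [Fintype.card_fin, nsmul_eq_mul]
    have hz : ((M ^ 3 : ℕ) : ℝ) * ((M : ℝ) ^ 3)⁻¹ - 1 = 0 := by
      push_cast; field_simp; ring
    rw [hz, add_zero]
  /- the within-cell part: `∫_Q (A_q/s³) klFun(s³φ/A_q) = ∫_Q φ log(s³φ/A_q)` -/
  have hwithin : ∀ q : Fin 3 → Fin M,
      ∫ x in subCell s q, A q / s ^ 3 * klFun (s ^ 3 * φ x / A q) =
        ∫ x in subCell s q, φ x * Real.log (s ^ 3 * φ x / A q) := by
    intro q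
    rcases (hA0 q).eq_or_lt with hAq | hAq
    · rw [← hAq]
      simp
    · have hpt : ∀ x, A q / s ^ 3 * klFun (s ^ 3 * φ x / A q) =
          φ x * Real.log (s ^ 3 * φ x / A q) + (A q / s ^ 3 - φ x) := by
        intro x; rw [klFun_apply]; field_simp; ring
      simp_rw [hpt]
      have iφ : IntegrableOn φ (subCell s q) := i2.integrableOn
      have hvq : volume (subCell s q) ≠ ⊤ := by
        rw [← routeCell_eq_subCell s q, CoarseChainRule.volume_cell hs.le q]; simp
      have ic : IntegrableOn (fun _ : Space => A q / s ^ 3) (subCell s q) := integrableOn_const hvq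
      have i3 : IntegrableOn (fun x => A q / s ^ 3 - φ x) (subCell s q) := ic.sub iφ
      rw [integral_add (hintOn (continuous_mul_log_mul_div hφc _ _) q) i3,
        integral_sub ic iφ, setIntegral_const, hvolQ q, smul_eq_mul, hAfold q]
      have hz : s ^ 3 * (A q / s ^ 3) - A q = 0 := by field_simp; ring
      rw [hz, add_zero]
  /- Step 5: assemble -/
  have hTeq : ∫ x, φ x * Real.log (L ^ 3 * φ x) =
      (∑ q : Fin 3 → Fin M, ((M : ℝ) ^ 3)⁻¹ * klFun ((M : ℝ) ^ 3 * A q)) +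
        ∑ q : Fin 3 → Fin M, ∫ x in subCell s q, A q / s ^ 3 * klFun (s ^ 3 * φ x / A q) := by
    rw [hTsum, ← hcoarse, ← Finset.sum_add_distrib]
    refine Finset.sum_congr rfl fun q _ => ?_
    rw [hsplit q, hwithin q, add_comm]
  rw [hTeq]
  exact ENNReal.ofReal_add_le

end CellChainRule

/-- **Stub `stub_cellChainRule` (crux `OneBodyEntropyBound`, line `registered`).** The exact KL chain
rule over the tiling of `[0,L)³` by `M³` half-open cells of side `L/M`, for the one-body marginal
`P¹(x) = ∫ |Ψ(x :: Y')|² dY'` of a trial state: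
`KL(P¹ ‖ u_Λ) ≤ Σ_k M⁻³ klFun(M³P_k) + Σ_k ∫_{Q_k} (P_k/s³) klFun(s³P¹/P_k)` in `[0,∞]`.
[cite: CoverThomas2005, Thm 2.5.3] -/
theorem stub_cellChainRule :
    ∀ (n : ℕ) (L : ℝ), 0 < L → ∀ (M : ℕ), 1 ≤ M → ∀ Ψ :
      Literature.MathematicalPhysics.QuantumManyBody.BoseGas.TrialState (n + 1) L, ∫⁻ x in
      Literature.MathematicalPhysics.QuantumManyBody.BoseGas.box L, ENNReal.ofReal ((L ^ 3)⁻¹ *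
      InformationTheory.klFun (L ^ 3 * (∫ Y' :
      Literature.MathematicalPhysics.QuantumManyBody.BoseGas.Config n, ‖Ψ.ψ (Matrix.vecCons x Y')‖
      ^ 2))) ≤ ENNReal.ofReal (∑ k : Fin 3 → Fin M, ((M : ℝ) ^ 3)⁻¹ * InformationTheory.klFun ((M :
      ℝ) ^ 3 * (∫ x in {y : EuclideanSpace ℝ (Fin 3) | ∀ j, y j ∈ Set.Ico (((k j : ℕ) : ℝ) * (L /
      (M : ℝ))) ((((k j : ℕ) : ℝ) + 1) * (L / (M : ℝ)))}, ∫ Y' :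
      Literature.MathematicalPhysics.QuantumManyBody.BoseGas.Config n, ‖Ψ.ψ (Matrix.vecCons x Y')‖
      ^ 2))) + ENNReal.ofReal (∑ k : Fin 3 → Fin M, ∫ x in {y : EuclideanSpace ℝ (Fin 3) | ∀ j, y j
      ∈ Set.Ico (((k j : ℕ) : ℝ) * (L / (M : ℝ))) ((((k j : ℕ) : ℝ) + 1) * (L / (M : ℝ)))}, (∫ z in
      {y : EuclideanSpace ℝ (Fin 3) | ∀ j, y j ∈ Set.Ico (((k j : ℕ) : ℝ) * (L / (M : ℝ))) ((((k j
      : ℕ) : ℝ) + 1) * (L / (M : ℝ)))}, ∫ Y' :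
      Literature.MathematicalPhysics.QuantumManyBody.BoseGas.Config n, ‖Ψ.ψ (Matrix.vecCons z Y')‖
      ^ 2) / (L / (M : ℝ)) ^ 3 * InformationTheory.klFun ((L / (M : ℝ)) ^ 3 * (∫ Y' :
      Literature.MathematicalPhysics.QuantumManyBody.BoseGas.Config n, ‖Ψ.ψ (Matrix.vecCons x Y')‖
      ^ 2) / (∫ z in {y : EuclideanSpace ℝ (Fin 3) | ∀ j, y j ∈ Set.Ico (((k j : ℕ) : ℝ) * (L / (M
      : ℝ))) ((((k j : ℕ) : ℝ) + 1) * (L / (M : ℝ)))}, ∫ Y' :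
      Literature.MathematicalPhysics.QuantumManyBody.BoseGas.Config n, ‖Ψ.ψ (Matrix.vecCons z Y')‖
      ^ 2))) := by
  intro n L hL M hM Ψ
  simp_rw [routeCell_eq_subCell]
  exact CellChainRule.lintegral_klFun_le_coarse_add_within hL hM
    (CellChainRule.continuous_integral_normSq_vecCons Ψ)
    (fun x => integral_nonneg fun Y => sq_nonneg _)
    (CellChainRule.integral_normSq_vecCons_eq_zero Ψ)
    (CellChainRule.integral_integral_normSq_vecCons' Ψ)

end Summit.AtomisticToContinuum.BoseEinsteinCondensation.Cruxes.OneBodyEntropyBound.Birth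

end
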